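import Mathlib.MeasureTheory.Measure.Prod
import Summits.CriticalPhenomena.Ising3DConformalLimit.Theses.SynchronousCoupling
import Summits.CriticalPhenomena.Ising3DConformalLimit.Theorems.HyperoctahedralRPExistsScaleCovariantLimitBlockMomentBounded
import Literature.Probability.LatticeModels.CriticalBlockMoments
import HarnessLib

/-!
# Tower rates of the critical block moments from the dilation joinings
(line `Sketch` of crux `JoiningsTransfer`, stmt-CriticalPhenomena-18764, route `SynchronousCoupling`; registered stub
`stub_towerCauchy`, the lead's stub D)

Write `R_n(L;k) = critBlockMoment n L k` for the normalised block moments of the critical nearest-neighbour Ising model on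
`ℤ³` (block `cube L + L•kᵢ`, normaliser `V(L)^{n/2}`, `V(L) = blockCov L 0`). The route's crux hypothesis `DilationJoinings`
provides, for `p ∈ {2, 3}`, constants `C, θ > 0` and for every block side `b ≥ 1` and window `m` a COUPLING `π` of the critical
measure with itself under which the normalised block spin of side `p b` at block position `u` (first copy) and the one of side `b`
at `u` (second copy) are `C b^{-θ}`-close in `L²(π)`, uniformly in `|uᵢ| ≤ m`.

**`stub_towerCauchy`**: given the moment-difference inequality (stub B) and the block-model dictionary (stub C), `DilationJoinings`
implies the BASE-UNIFORM TOWER RATES `|R_n(2L;k) − R_n(L;k)|, |R_n(3L;k) − R_n(L;k)| ≤ C' L^{-θ'}` for every `L ≥ 1` — the first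
hypothesis of the two-base Croft lemma (stub A). Proof: both moments are `π`-expectations of products of the coupled normalised block
spins (marginals of `π` are `μ`; `Measure.fst/snd`, `integral_map`), the `2(n−1)`-th moments are bounded uniformly in the side by the
landed `stub_blockMomentBounded` (Griffiths + Newman's Gaussian inequality), and the moment-difference inequality gives
`|ΔR| ≤ n √(C L^{-θ}) √M`.

References: G. Kozma, *The scaling limit of loop-erased random walk in three dimensions*, Acta Math. 199 (2007) §6.1 (the
cross-mesh coupling architecture); C. M. Newman, Z. Wahrsch. 33 (1975) (Gaussian domination). No definitions, no `sorry`.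
-/

noncomputable section

namespace Summit.CriticalPhenomena.Ising3DConformalLimit.Cruxes.JoiningsTransfer.Sketch

open Literature.Probability.LatticeModels MeasureTheory Filter Set
open scoped Topology BigOperators
open Summit.CriticalPhenomena.Ising3DConformalLimit.Theses
open Summit.CriticalPhenomena.Ising3DConformalLimit.Cruxes.ExistsScaleCovariantLimit.MonotoneBlockingPort

/-! ## Block sums: reindexing DJ's boxes to `cube`, measurability, bounds -/

/-- DJ's block `∏ᵢ [L uᵢ, L uᵢ + L)` is the translate `cube L + L•u`: sums reindex. [folklore] -/
theorem towerCauchy_sum_box_eq_sum_cube (L : ℕ) (u : Fin 3 → ℤ) (f : Site 3 → ℝ) :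
    ∑ x ∈ Fintype.piFinset (fun i : Fin 3 => Finset.Ico ((L : ℤ) * u i) ((L : ℤ) * u i + (L : ℤ))), f x =
      ∑ x ∈ cube L, f (x + (L : ℤ) • u) := by
  refine (Finset.sum_equiv (Equiv.addRight ((L : ℤ) • u)) (fun x => ?_) (fun x _ => rfl)).symm
  simp only [Equiv.coe_addRight, Fintype.mem_piFinset, Finset.mem_Ico, mem_cube, Pi.add_apply, Pi.smul_apply,
    smul_eq_mul]
  constructor
  · intro h i
    obtain ⟨h1, h2⟩ := h i
    constructor <;> linarith
  · intro h i
    obtain ⟨h1, h2⟩ := h i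
    constructor <;> linarith

/-- `cube (p b)` written with the product cast `(p:ℤ) * b`, as in `DilationJoinings`. [folklore] -/
theorem towerCauchy_cube_mul (p b : ℕ) :
    Fintype.piFinset (fun _ : Fin 3 => Finset.Ico (0 : ℤ) ((p : ℤ) * b)) = cube (p * b) := by
  simp [cube, Nat.cast_mul]

/-- The normalised shifted block spin is measurable. [folklore] -/
theorem towerCauchy_measurable_block (c : ℝ) (L : ℕ) (u : Site 3) :
    Measurable fun σ : SpinConfig (Site 3) => c * ∑ x ∈ cube L, spinAt (x + (L : ℤ) • u) σ :=
  (Finset.measurable_sum _ fun _ _ => measurable_spinAt _).const_mul c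

/-- DJ's block of side `(p:ℤ) * b` reindexed to `cube (p b)`. [folklore] -/
theorem towerCauchy_sum_box_mul_eq_sum_cube (p b : ℕ) (u : Fin 3 → ℤ) (f : Site 3 → ℝ) :
    ∑ x ∈ Fintype.piFinset (fun i : Fin 3 => Finset.Ico ((p : ℤ) * b * u i) ((p : ℤ) * b * u i + (p : ℤ) * b)), f x =
      ∑ x ∈ cube (p * b), f (x + ((p * b : ℕ) : ℤ) • u) := by
  rw [← towerCauchy_sum_box_eq_sum_cube (p * b) u f, Nat.cast_mul]

/-- `cube b` is literally DJ's block of the second copy at the origin. [folklore] -/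
theorem towerCauchy_cube_eq (b : ℕ) : Fintype.piFinset (fun _ : Fin 3 => Finset.Ico (0 : ℤ) (b : ℤ)) = cube b := rfl

/-- The normalised shifted block spin is bounded by `|c| L³`. [folklore] -/
theorem towerCauchy_abs_block_le (c : ℝ) (L : ℕ) (u : Site 3) (σ : SpinConfig (Site 3)) :
    |c * ∑ x ∈ cube L, spinAt (x + (L : ℤ) • u) σ| ≤ |c| * (L : ℝ) ^ 3 := by
  rw [abs_mul]
  refine mul_le_mul_of_nonneg_left ?_ (abs_nonneg c)
  calc |∑ x ∈ cube L, spinAt (x + (L : ℤ) • u) σ| ≤ ∑ x ∈ cube L, |spinAt (x + (L : ℤ) • u) σ| :=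
        Finset.abs_sum_le_sum_abs _ _
    _ = (L : ℝ) ^ 3 := by simp [card_cube]

/-! ## Couplings: marginals and expectations of one-copy observables -/

/-- A coupling whose first marginal is a probability measure is a probability measure. [folklore] -/
theorem towerCauchy_isProbabilityMeasure_of_fst {μ : Measure (SpinConfig (Site 3))} [IsProbabilityMeasure μ]
    {π : Measure (SpinConfig (Site 3) × SpinConfig (Site 3))} (h : π.fst = μ) : IsProbabilityMeasure π :=
  ⟨by rw [← Measure.fst_univ, h, measure_univ]⟩

/-- Expectation under a coupling of a measurable function of the FIRST copy. [folklore] -/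
theorem towerCauchy_integral_comp_fst {μ : Measure (SpinConfig (Site 3))}
    {π : Measure (SpinConfig (Site 3) × SpinConfig (Site 3))} (h : π.fst = μ)
    {F : SpinConfig (Site 3) → ℝ} (hF : Measurable F) :
    ∫ q, F q.1 ∂π = ∫ σ, F σ ∂μ := by
  rw [← h, Measure.fst, integral_map measurable_fst.aemeasurable hF.aestronglyMeasurable]

/-- Expectation under a coupling of a measurable function of the SECOND copy. [folklore] -/
theorem towerCauchy_integral_comp_snd {μ : Measure (SpinConfig (Site 3))}
    {π : Measure (SpinConfig (Site 3) × SpinConfig (Site 3))} (h : π.snd = μ)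
    {F : SpinConfig (Site 3) → ℝ} (hF : Measurable F) :
    ∫ q, F q.2 ∂π = ∫ σ, F σ ∂μ := by
  rw [← h, Measure.snd, integral_map measurable_snd.aemeasurable hF.aestronglyMeasurable]

/-! ## One prime: the joining at side ratio `p` gives `|R_n(pL;k) − R_n(L;k)| ≤ n √(C L^{-θ}) √M` -/

/-- **Tower step at one prime.** Under a coupling `π` of `μ` with itself whose normalised block spins of sides `pL` (copy 1) and
`L` (copy 2) are `η = C L^{-θ}`-close in `L²(π)` at every block position `kᵢ` (the `DilationJoinings` clause for this `p`), the block
moments satisfy `|R_n(pL;k) − R_n(L;k)| ≤ n √η √M`, `M` a bound on the `2(n−1)`-th moments of the normalised block spins: both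
moments are `π`-expectations of products (marginals), and the moment-difference inequality `hMD` applies. [folklore] -/
theorem towerCauchy_step
    (hMD : ∀ (Ω : Type) [MeasurableSpace Ω] (P : Measure Ω) [IsProbabilityMeasure P] (n : ℕ)
      (Y Z : Fin n → Ω → ℝ) (M η : ℝ),
      (∀ i, Measurable (Y i)) → (∀ i, Measurable (Z i)) →
      (∀ i, ∃ B : ℝ, ∀ ω, |Y i ω| ≤ B ∧ |Z i ω| ≤ B) →
      (∀ i, ∫ ω, (Y i ω) ^ (2 * (n - 1)) ∂P ≤ M) → (∀ i, ∫ ω, (Z i ω) ^ (2 * (n - 1)) ∂P ≤ M) →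
      (∀ i, ∫ ω, (Y i ω - Z i ω) ^ 2 ∂P ≤ η) →
      |(∫ ω, ∏ i, Y i ω ∂P) - ∫ ω, ∏ i, Z i ω ∂P| ≤ n * Real.sqrt η * Real.sqrt M)
    {μ : Measure (SpinConfig (Site 3))} [IsProbabilityMeasure μ]
    (hV : ∀ L : ℕ, blockCov L 0 = ∫ σ, (∑ x ∈ cube L, spinAt x σ) ^ 2 ∂μ)
    (hR : ∀ (n L : ℕ) (k : Fin n → Site 3), critBlockMoment n L k =
      ∫ σ, ∏ i, ((Real.sqrt (blockCov L 0))⁻¹ * ∑ x ∈ cube L, spinAt (x + (L : ℤ) • k i) σ) ∂μ)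
    {p : ℕ} (hp : 1 ≤ p) {C θ : ℝ}
    (Hp : ∀ b m : ℕ, 1 ≤ b → ∃ π : Measure (SpinConfig (Site 3) × SpinConfig (Site 3)), π.fst = μ ∧ π.snd = μ ∧
      ∀ u : Fin 3 → ℤ, (∀ i, |u i| ≤ m) →
        ∫ q, ((Real.sqrt (∫ σ, (∑ x ∈ Fintype.piFinset (fun _ : Fin 3 => Finset.Ico (0:ℤ) ((p:ℤ) * b)),
            spinAt x σ) ^ 2 ∂μ))⁻¹ *
            (∑ x ∈ Fintype.piFinset (fun i : Fin 3 => Finset.Ico ((p:ℤ) * b * u i) ((p:ℤ) * b * u i + (p:ℤ) * b)),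
              spinAt x q.1) -
          (Real.sqrt (∫ σ, (∑ x ∈ Fintype.piFinset (fun _ : Fin 3 => Finset.Ico (0:ℤ) ((b:ℤ))), spinAt x σ) ^ 2 ∂μ))⁻¹ *
            (∑ x ∈ Fintype.piFinset (fun i : Fin 3 => Finset.Ico ((b:ℤ) * u i) ((b:ℤ) * u i + (b:ℤ))),
              spinAt x q.2)) ^ 2 ∂π ≤ C * (b : ℝ) ^ (-θ))
    {n : ℕ} (k : Fin n → Site 3) {M : ℝ}
    (hM : ∀ (i : Fin n) (L : ℕ), 1 ≤ L →
      ∫ σ, ((Real.sqrt (blockCov L 0))⁻¹ * ∑ x ∈ cube L, spinAt (x + (L : ℤ) • k i) σ) ^ (2 * (n - 1)) ∂μ ≤ M)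
    {m : ℕ} (hm : ∀ i j, |k i j| ≤ m) (L : ℕ) (hL : 1 ≤ L) :
    |critBlockMoment n (p * L) k - critBlockMoment n L k| ≤ n * Real.sqrt (C * (L : ℝ) ^ (-θ)) * Real.sqrt M := by
  obtain ⟨π, hfst, hsnd, hπ⟩ := Hp L m hL
  haveI : IsProbabilityMeasure π := towerCauchy_isProbabilityMeasure_of_fst hfst
  -- the coupled normalised block spins
  set Y : Fin n → SpinConfig (Site 3) × SpinConfig (Site 3) → ℝ := fun i q =>
    (Real.sqrt (blockCov (p * L) 0))⁻¹ * ∑ x ∈ cube (p * L), spinAt (x + ((p * L : ℕ) : ℤ) • k i) q.1 with hYdef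
  set Z : Fin n → SpinConfig (Site 3) × SpinConfig (Site 3) → ℝ := fun i q =>
    (Real.sqrt (blockCov L 0))⁻¹ * ∑ x ∈ cube L, spinAt (x + (L : ℤ) • k i) q.2 with hZdef
  have hYm : ∀ i, Measurable (Y i) := fun i =>
    (towerCauchy_measurable_block _ (p * L) (k i)).comp measurable_fst
  have hZm : ∀ i, Measurable (Z i) := fun i =>
    (towerCauchy_measurable_block _ L (k i)).comp measurable_snd
  -- expectations of the products are the block moments
  have hEY : ∫ q, ∏ i, Y i q ∂π = critBlockMoment n (p * L) k := by
    rw [hR]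
    exact towerCauchy_integral_comp_fst hfst
      (F := fun σ => ∏ i, (Real.sqrt (blockCov (p * L) 0))⁻¹ * ∑ x ∈ cube (p * L), spinAt (x + ((p * L : ℕ) : ℤ) • k i) σ)
      (Finset.measurable_prod _ fun i _ => towerCauchy_measurable_block _ (p * L) (k i))
  have hEZ : ∫ q, ∏ i, Z i q ∂π = critBlockMoment n L k := by
    rw [hR]
    exact towerCauchy_integral_comp_snd hsnd
      (F := fun σ => ∏ i, (Real.sqrt (blockCov L 0))⁻¹ * ∑ x ∈ cube L, spinAt (x + (L : ℤ) • k i) σ)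
      (Finset.measurable_prod _ fun i _ => towerCauchy_measurable_block _ L (k i))
  -- bounds
  have hbd : ∀ i, ∃ B : ℝ, ∀ q, |Y i q| ≤ B ∧ |Z i q| ≤ B := by
    intro i
    refine ⟨max (|(Real.sqrt (blockCov (p * L) 0))⁻¹| * ((p * L : ℕ) : ℝ) ^ 3)
      (|(Real.sqrt (blockCov L 0))⁻¹| * (L : ℝ) ^ 3), fun q => ⟨?_, ?_⟩⟩
    · exact (towerCauchy_abs_block_le _ (p * L) (k i) q.1).trans (le_max_left _ _)
    · exact (towerCauchy_abs_block_le _ L (k i) q.2).trans (le_max_right _ _)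
  -- moments
  have hpL : 1 ≤ p * L := Nat.one_le_iff_ne_zero.2 (Nat.mul_ne_zero (by omega) (by omega))
  have hmomY : ∀ i, ∫ q, (Y i q) ^ (2 * (n - 1)) ∂π ≤ M := by
    intro i
    have e := towerCauchy_integral_comp_fst hfst
      (F := fun σ => ((Real.sqrt (blockCov (p * L) 0))⁻¹ *
        ∑ x ∈ cube (p * L), spinAt (x + ((p * L : ℕ) : ℤ) • k i) σ) ^ (2 * (n - 1)))
      ((towerCauchy_measurable_block _ (p * L) (k i)).pow_const _)
    simp only [hYdef]
    rw [e]
    exact hM i (p * L) hpL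
  have hmomZ : ∀ i, ∫ q, (Z i q) ^ (2 * (n - 1)) ∂π ≤ M := by
    intro i
    have e := towerCauchy_integral_comp_snd hsnd
      (F := fun σ => ((Real.sqrt (blockCov L 0))⁻¹ * ∑ x ∈ cube L, spinAt (x + (L : ℤ) • k i) σ) ^ (2 * (n - 1)))
      ((towerCauchy_measurable_block _ L (k i)).pow_const _)
    simp only [hZdef]
    rw [e]
    exact hM i L hL
  -- increments: the DilationJoinings clause, reindexed
  have hinc : ∀ i, ∫ q, (Y i q - Z i q) ^ 2 ∂π ≤ C * (L : ℝ) ^ (-θ) := by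
    intro i
    have h := hπ (k i) (fun j => hm i j)
    simp only [towerCauchy_cube_mul, towerCauchy_cube_eq, towerCauchy_sum_box_mul_eq_sum_cube,
      towerCauchy_sum_box_eq_sum_cube, ← hV] at h
    simpa only [hYdef, hZdef] using h
  have key := hMD (SpinConfig (Site 3) × SpinConfig (Site 3)) π n Y Z M (C * (L : ℝ) ^ (-θ)) hYm hZm hbd hmomY hmomZ hinc
  rwa [hEY, hEZ] at key

/-! ## The stub -/

/-- **Stub D `stub_towerCauchy`** of line `Sketch` (crux `JoiningsTransfer`): the moment-difference inequality, the block-model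
dictionary and `DilationJoinings` give base-uniform 2- and 3-tower rates for every normalised critical block moment:
`|R_n(2L;k) − R_n(L;k)|, |R_n(3L;k) − R_n(L;k)| ≤ C L^{-θ}` for all `L ≥ 1`. [folklore] -/
theorem stub_towerCauchy :
    (∀ (Ω : Type) [MeasurableSpace Ω] (P : Measure Ω) [IsProbabilityMeasure P] (n : ℕ)
      (Y Z : Fin n → Ω → ℝ) (M η : ℝ),
      (∀ i, Measurable (Y i)) → (∀ i, Measurable (Z i)) →
      (∀ i, ∃ B : ℝ, ∀ ω, |Y i ω| ≤ B ∧ |Z i ω| ≤ B) →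
      (∀ i, ∫ ω, (Y i ω) ^ (2 * (n - 1)) ∂P ≤ M) → (∀ i, ∫ ω, (Z i ω) ^ (2 * (n - 1)) ∂P ≤ M) →
      (∀ i, ∫ ω, (Y i ω - Z i ω) ^ 2 ∂P ≤ η) →
      |(∫ ω, ∏ i, Y i ω ∂P) - ∫ ω, ∏ i, Z i ω ∂P| ≤ n * Real.sqrt η * Real.sqrt M) →
    (∃ μ : Measure (SpinConfig (Site 3)),
      μ ∈ isingGibbsMeasures 3 (criticalBeta 3) 0 ∧ IsTranslationInvariantMeasure μ ∧ IsProbabilityMeasure μ ∧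
      (∀ (n : ℕ) (y : Fin n → Site 3), criticalCorr 3 n y = ∫ σ, spinMonomial y σ ∂μ) ∧
      (∀ L : ℕ, blockCov L 0 = ∫ σ, (∑ x ∈ cube L, spinAt x σ) ^ 2 ∂μ) ∧
      (∀ (n L : ℕ) (k : Fin n → Site 3), critBlockMoment n L k =
        ∫ σ, ∏ i, ((Real.sqrt (blockCov L 0))⁻¹ * ∑ x ∈ cube L, spinAt (x + (L : ℤ) • k i) σ) ∂μ)) →
    SynchronousCoupling.DilationJoinings →
    ∀ (n : ℕ) (k : Fin n → Site 3), ∃ C θ : ℝ, 0 < θ ∧ ∀ L : ℕ, 1 ≤ L →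
      |critBlockMoment n (2 * L) k - critBlockMoment n L k| ≤ C * (L : ℝ) ^ (-θ) ∧
      |critBlockMoment n (3 * L) k - critBlockMoment n L k| ≤ C * (L : ℝ) ^ (-θ) := by
  intro hMD hBM hDJ n k
  obtain ⟨μ, hμG, hTI, hP, _hcorr, hV, hR⟩ := hBM
  -- the two joinings
  obtain ⟨C₂, θ₂, hθ₂, H₂⟩ := hDJ μ hμG hTI 2 (Or.inl rfl)
  obtain ⟨C₃, θ₃, hθ₃, H₃⟩ := hDJ μ hμG hTI 3 (Or.inr rfl)
  -- window containing every block position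
  obtain ⟨m, hm⟩ : ∃ m : ℕ, ∀ i j, |k i j| ≤ m := by
    refine ⟨∑ i, ∑ j, (k i j).natAbs, fun i j => ?_⟩
    have h1 : (k i j).natAbs ≤ ∑ j', (k i j').natAbs :=
      Finset.single_le_sum (f := fun j' => (k i j').natAbs) (fun _ _ => Nat.zero_le _) (Finset.mem_univ j)
    have h2 : ∑ j', (k i j').natAbs ≤ ∑ i', ∑ j', (k i' j').natAbs :=
      Finset.single_le_sum (f := fun i' => ∑ j', (k i' j').natAbs) (fun _ _ => Nat.zero_le _) (Finset.mem_univ i)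
    rw [Int.abs_eq_natAbs]
    exact_mod_cast h1.trans h2
  -- uniform bound on the `2(n-1)`-th moments of the normalised block spins (Newman's Gaussian domination, landed)
  obtain ⟨M, hM⟩ : ∃ M : ℝ, ∀ (i : Fin n) (L : ℕ), 1 ≤ L →
      ∫ σ, ((Real.sqrt (blockCov L 0))⁻¹ * ∑ x ∈ cube L, spinAt (x + (L : ℤ) • k i) σ) ^ (2 * (n - 1)) ∂μ ≤ M := by
    haveI := hP
    choose Cb hCb using fun i : Fin n => stub_blockMomentBounded (2 * (n - 1)) (fun _ : Fin (2 * (n - 1)) => k i)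
    refine ⟨∑ i, |Cb i|, fun i L hL => ?_⟩
    have e : ∫ σ, ((Real.sqrt (blockCov L 0))⁻¹ * ∑ x ∈ cube L, spinAt (x + (L : ℤ) • k i) σ) ^ (2 * (n - 1)) ∂μ =
        critBlockMoment (2 * (n - 1)) L (fun _ => k i) := by
      rw [hR]
      simp only [Finset.prod_const, Finset.card_univ, Fintype.card_fin]
    rw [e]
    calc critBlockMoment (2 * (n - 1)) L (fun _ => k i) ≤ |critBlockMoment (2 * (n - 1)) L (fun _ => k i)| :=
          le_abs_self _
      _ ≤ Cb i := hCb i L hL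
      _ ≤ |Cb i| := le_abs_self _
      _ ≤ ∑ i', |Cb i'| :=
          Finset.single_le_sum (f := fun i' => |Cb i'|) (fun _ _ => abs_nonneg _) (Finset.mem_univ i)
  haveI := hP
  have step2 := fun L hL => towerCauchy_step hMD hV hR (p := 2) (by norm_num) H₂ k hM hm L hL
  have step3 := fun L hL => towerCauchy_step hMD hV hR (p := 3) (by norm_num) H₃ k hM hm L hL
  -- constants: `C₂, C₃ ≥ 0` (the `L²` defects are nonnegative), `θ := min θ₂ θ₃ / 2`
  refine ⟨n * Real.sqrt M * (Real.sqrt |C₂| + Real.sqrt |C₃|), min θ₂ θ₃ / 2, by positivity, fun L hL => ?_⟩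
  have hL1 : (1 : ℝ) ≤ L := by exact_mod_cast hL
  have hL0 : (0 : ℝ) < L := by positivity
  have hsq : ∀ (C' θ' : ℝ), min θ₂ θ₃ ≤ θ' →
      Real.sqrt (C' * (L : ℝ) ^ (-θ')) ≤ Real.sqrt |C'| * (L : ℝ) ^ (-(min θ₂ θ₃ / 2)) := by
    intro C' θ' hθ'
    have h1 : C' * (L : ℝ) ^ (-θ') ≤ |C'| * (L : ℝ) ^ (-θ') :=
      mul_le_mul_of_nonneg_right (le_abs_self _) (Real.rpow_nonneg hL0.le _)
    calc Real.sqrt (C' * (L : ℝ) ^ (-θ')) ≤ Real.sqrt (|C'| * (L : ℝ) ^ (-θ')) := Real.sqrt_le_sqrt h1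
      _ = Real.sqrt |C'| * (L : ℝ) ^ (-θ' / 2) := by
          rw [Real.sqrt_mul (abs_nonneg _), Real.sqrt_eq_rpow ((L : ℝ) ^ (-θ')), ← Real.rpow_mul hL0.le]
          congr 2
          ring
      _ ≤ Real.sqrt |C'| * (L : ℝ) ^ (-(min θ₂ θ₃ / 2)) := by
          refine mul_le_mul_of_nonneg_left ?_ (Real.sqrt_nonneg _)
          exact Real.rpow_le_rpow_of_exponent_le hL1 (by linarith)
  have hn : (0 : ℝ) ≤ n * Real.sqrt M := by positivity
  constructor
  · calc |critBlockMoment n (2 * L) k - critBlockMoment n L k|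
        ≤ n * Real.sqrt (C₂ * (L : ℝ) ^ (-θ₂)) * Real.sqrt M := step2 L hL
      _ = n * Real.sqrt M * Real.sqrt (C₂ * (L : ℝ) ^ (-θ₂)) := by ring
      _ ≤ n * Real.sqrt M * (Real.sqrt |C₂| * (L : ℝ) ^ (-(min θ₂ θ₃ / 2))) :=
          mul_le_mul_of_nonneg_left (hsq C₂ θ₂ (min_le_left _ _)) hn
      _ ≤ n * Real.sqrt M * ((Real.sqrt |C₂| + Real.sqrt |C₃|) * (L : ℝ) ^ (-(min θ₂ θ₃ / 2))) := by
          refine mul_le_mul_of_nonneg_left (mul_le_mul_of_nonneg_right ?_ (Real.rpow_nonneg hL0.le _)) hn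
          linarith [Real.sqrt_nonneg |C₃|]
      _ = n * Real.sqrt M * (Real.sqrt |C₂| + Real.sqrt |C₃|) * (L : ℝ) ^ (-(min θ₂ θ₃ / 2)) := by ring
  · calc |critBlockMoment n (3 * L) k - critBlockMoment n L k|
        ≤ n * Real.sqrt (C₃ * (L : ℝ) ^ (-θ₃)) * Real.sqrt M := step3 L hL
      _ = n * Real.sqrt M * Real.sqrt (C₃ * (L : ℝ) ^ (-θ₃)) := by ring
      _ ≤ n * Real.sqrt M * (Real.sqrt |C₃| * (L : ℝ) ^ (-(min θ₂ θ₃ / 2))) :=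
          mul_le_mul_of_nonneg_left (hsq C₃ θ₃ (min_le_right _ _)) hn
      _ ≤ n * Real.sqrt M * ((Real.sqrt |C₂| + Real.sqrt |C₃|) * (L : ℝ) ^ (-(min θ₂ θ₃ / 2))) := by
          refine mul_le_mul_of_nonneg_left (mul_le_mul_of_nonneg_right ?_ (Real.rpow_nonneg hL0.le _)) hn
          linarith [Real.sqrt_nonneg |C₂|]
      _ = n * Real.sqrt M * (Real.sqrt |C₂| + Real.sqrt |C₃|) * (L : ℝ) ^ (-(min θ₂ θ₃ / 2)) := by ring

end Summit.CriticalPhenomena.Ising3DConformalLimit.Cruxes.JoiningsTransfer.Sketch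

end
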